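import Literature.AnabelianGeometry.EtaleTheta.Discharge.Sec5OfConnectedTemperoid
import Literature.AnabelianGeometry.EtaleTheta.Discharge.Sec4Prop42Schema
import Literature.AnabelianGeometry.EtaleTheta.Discharge.Sec4Prop42Weak
import Literature.AnabelianGeometry.EtaleTheta.Discharge.Sec4Prop42iiIff

/-!
# [EtTh] Prop 4.2 (i) (and the typed (ii), with print's «iff») at the GENUINE CONNECTED base
# `D := B^temp(Π^tp_X)⁰` — binder-free over both canonical monoid vocabularies

Mochizuki, *The étale theta function and its Frobenioid-theoretic manifestations*, Publ. RIMS **45** (2009),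
§4, Prop. 4.2 (i), (ii): statement PDF p. 88 (printed p. 314; kurims-ms p. 80 l.17–26), proof PDF p. 89
(printed p. 315; «sufficiency is immediate; necessity … [FrdI] Def. 1.3 (iii)(d) … disjoint supports … totally
epimorphic»; (ii) «entirely similar») [cite: MochizukiEtTh2009, Prop 4.2 p.88]; Def. 3.6 (ii) PDF p. 76
(«`D` connected, totally epimorphic», «`Φ` perf-factorial»); Def. 4.1 PDF pp. 86–87.
abc-iut cell, layer L2, cone node **`EtTh:Prop4.2(i)`** (kernel id `N_EtTh_Prop4_2_i`, plan/CONE-CLASSIFY class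
CLAIM-NOW; FACT-LIST F-0488 `BiKummerSetting.Prop42_i` = «universal-closure REFUTED / schema; decided AT NAMED
INSTANCES»), companion rows for `EtTh:Prop4.2(ii)` (F-0489).  Seat abc-iut-w5-d063 (gen 6; R-C discharge prover,
[EtTh] §4 lineage).  PROOF-ONLY companion: 0 `def`, 0 `instance`, no named fact; every theorem is a BY-NAME
instantiation of landed theorems; nothing landed is edited or restated.

## What was on record, and what this file adds

The typed statement `BiKummerSetting.Prop42_i S` renders print's (i) in full («iff» with «necessarily
unique»).  Its universal closure over an ARBITRARY abstract setting `S` is kernel-false (abc-iut-f-108,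
`Toy.not_forall_prop42_i`, `Discharge/Sec4Prop42Schema.lean`), because the abstract `BiKummerSetting` leaves the
birational vocabulary free; so the node is decided at the instance family of record, abc-iut-L2-t9's canonical
model `mkOfModelCanonical` (birationalization := the model Frobenioid's, [FrdI] Thm. 5.2 (ii); disjoint
supports := [FrdI] Prop. 4.1 (iii)), where it is a theorem modulo «every `Φ(A)` perf-factorial»
(`prop42_i_mkOfModelCanonical`, abc-iut-L6-t12 / L2-t9), modulo the WEAK form (`…_of_weak`, abc-iut-w6-d037) and
with NO hypothesis over the canonical vocabularies `treeMonoidVocab` (`…_treeVocab`, abc-iut-f-108) /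
`treeMonoidVocabWeak` (`…_treeVocabWeak`, abc-iut-w6-d037) — all over an ARBITRARY base category `D` with
abstract Galois data `(IG, gS)`.

Print's `C` lives over the GENUINE CONNECTED base `D := B^temp(Π^tp_X)⁰ = ConnectedPart (BTemp X.Pi)` (Def. 3.6
(ii); the full temperoid carries no tempered Frobenioid, abc-iut-w4-d099 `TemperedFrobenioid.isEmpty_of_bTemp`),
with Galois objects := [SemiAnbd] Def. 3.1 (iv) and Galois surjections := `galoisSurjOf` — abc-iut-L2-t4's
`mkOfConnectedTemperoid X tf hZ hP NH A₀ hA₀ hA₀'` (`Discharge/Sec5OfConnectedTemperoid.lean`), the §4/§5 instance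
of record at which the cell re-closed Prop. 4.2 (iii)/(iv) and Prop. 4.3 (i)/(iii)
(`Sec4Prop42OfConnectedTemperoid`, `Sec4Prop42ivRootsReading`, `Sec4Prop43NodesReclosedIsGalois`).  For (i)/(ii)
no statement at that base was on record.  This file records them, each a one-line instantiation
(`mkOfConnectedTemperoid` IS `mkOfModelCanonical` at the temperoid's Galois data):

* §1 (any monoid vocabulary `V`): `prop42_i_mkOfConnectedTemperoid (hpf)` / `…_of_weak (hpf)`; the (ii)-twins;
  print's full «iff» for (ii) `prop42_ii_iff_mkOfConnectedTemperoid_of_weak` (abc-iut-w6-d037's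
  `prop42_ii_iff_mkOfModelCanonical_of_weak`); and the same at the canonical `A_⊙ := (Π^tp_X/M, 0)`
  (`mkOfConnectedTemperoidQuot`) and at the §5 choice `A_⊙^bs := Ÿ` (`mkOfConnectedTemperoidYdd`).
  The ONLY binder is Def. 3.6 (ii)'s «`Φ` perf-factorial» (strong or weak form) — a field of the printed
  definition, not a law.
* §2 (`V := treeMonoidVocab`, [FrdI] Def. 2.4 (i) as printed): **NO binder at all** — theorems about EVERY tempered
  Frobenioid `tf` of monoid type `ℤ` with perfect `Φ` over `B^temp(Π^tp_X)⁰`, EVERY `(N, H)`-saturation reading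
  `NH`, EVERY Frobenius-trivial Galois `A_⊙` (resp. every open normal `M ⊴ Π^tp_X`, every `ιX : Π_X^{Θ-env} ≃ Π^tp_X`);
  FQ-head forms `prop42_i_holds_mkOfConnectedTemperoid_treeVocab :
  Literature.AnabelianGeometry.EtaleTheta.BiKummerSetting.Prop42_i (mkOfConnectedTemperoid …)` (cell FQ-TYPE rule /
  F-0488 «instance form» head match), and the Quot/Ydd heads.
* §3 (`V := treeMonoidVocabWeak`, the vocabulary of record at coverings with infinitely many special-fibre
  components, F-L2d2-1): the same, binder-free, with the vocabulary named in the statement.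

NODE READING for `EtTh:Prop4.2(i)` (numbers, not adjectives): printed clause count 1 («iff» incl. «necessarily
unique») = typed `Prop42_i` (1 decl); AS TYPED it is a THEOREM with 0 hypotheses at the genuine connected base
over both canonical vocabularies, for every `tf`/`NH`/`A_⊙`; over an arbitrary abstract `S` the ∀-closure is
refuted (schema) — nothing in print is refuted (print's `C` IS a model Frobenioid with its own
birationalization).  HONEST FRAMING: [EtTh] is a refereed prerequisite paper; the parameter class
`TemperedFrobenioid T₀ (ConnectedPart (BTemp X.Pi)) VD` is not shown inhabited here (abc-iut-L2-t10 / L2-t3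
lineages own the junction data); typed ≠ proved elsewhere; nothing here bears on, or takes a side on,
[IUTchIII] Cor. 3.12; no abc claim.
-/

noncomputable section

namespace Literature.AnabelianGeometry.EtaleTheta

open CategoryTheory Opposite Literature.AlgebraicGeometry.Frobenioids Literature.AnabelianGeometry.SemiGraphs
  Literature.AnabelianGeometry.SemiGraphs.GaloisObjects Literature.AlgebraicGeometry.Frobenioids.QuasiTemperoid.BTempConnected

universe u₀ v₀ w

variable {K : Type u₀} [Field K]

namespace BiKummerSetting

/-! ## §1 Any monoid vocabulary: the only binder is Def. 3.6 (ii)'s «`Φ` perf-factorial» -/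

section AnyVocab

variable (X : SemiGraphs.TemperedArithmeticGroup.{u₀} K) {D₀ : Type u₀} [Category.{v₀} D₀]
  {V : FrdIMonoidStub.{w}} {T₀ : RealifiedDivisorMonoids (D₀ := D₀) V}
  {VD : FrdICatStub.{u₀ + 1, u₀, w} (ConnectedPart (BTemp X.Pi))}
  (tf : TemperedFrobenioid T₀ (ConnectedPart (BTemp X.Pi)) VD) (hZ : tf.monoidType = MonoidType.Z)
  (hP : ∀ A : (ConnectedPart (BTemp X.Pi))ᵒᵖ, IsPerfect (tf.Φ.carrier A))
  (NH : Subgroup (Field.absoluteGaloisGroup K) → tf.category → ℕ+ → Prop)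

section Setting

variable (A₀ : tf.category) (hA₀ : PreFrobenioid.IsFrobeniusTrivial tf.toElem A₀)
  (hA₀' : SemiGraphs.IsGaloisObj A₀.base.obj)

/-- **[EtTh] Prop. 4.2 (i) AS TYPED over the GENUINE CONNECTED base `B^temp(Π^tp_X)⁰`** at abc-iut-L2-t4's
`mkOfConnectedTemperoid`, modulo «every `Φ(A)` perf-factorial» (Def. 3.6 (ii)) ONLY: abc-iut-L2-t9's
`prop42_i_mkOfModelCanonical` read at the temperoid's Galois data. [cite: MochizukiEtTh2009, Prop 4.2 p.88] -/
theorem prop42_i_mkOfConnectedTemperoid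
    (hpf : ∀ A : (ConnectedPart (BTemp X.Pi))ᵒᵖ, IsPerfFactorial (tf.Φ.carrier A)) :
    (mkOfConnectedTemperoid X tf hZ hP NH A₀ hA₀ hA₀').Prop42_i :=
  prop42_i_mkOfModelCanonical X tf hZ hP _ _ _ NH A₀ hA₀ hA₀' hpf

/-- **[EtTh] Prop. 4.2 (i) AS TYPED over `B^temp(Π^tp_X)⁰` from WEAK perf-factoriality** (abc-iut-w6-d037's
`prop42_i_mkOfModelCanonical_of_weak`). [cite: MochizukiEtTh2009, Prop 4.2 p.88] -/
theorem prop42_i_mkOfConnectedTemperoid_of_weak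
    (hpfw : ∀ A : (ConnectedPart (BTemp X.Pi))ᵒᵖ, IsPerfFactorialWeak (tf.Φ.carrier A)) :
    (mkOfConnectedTemperoid X tf hZ hP NH A₀ hA₀ hA₀').Prop42_i :=
  prop42_i_mkOfModelCanonical_of_weak X tf hZ hP _ _ _ NH A₀ hA₀ hA₀' hpfw

/-- **[EtTh] Prop. 4.2 (ii) AS TYPED (necessity + uniqueness) over `B^temp(Π^tp_X)⁰`**, modulo «every `Φ(A)`
perf-factorial» only (abc-iut-L2-t9's `prop42_ii_mkOfModelCanonical`). [cite: MochizukiEtTh2009, Prop 4.2 p.88] -/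
theorem prop42_ii_mkOfConnectedTemperoid
    (hpf : ∀ A : (ConnectedPart (BTemp X.Pi))ᵒᵖ, IsPerfFactorial (tf.Φ.carrier A)) :
    (mkOfConnectedTemperoid X tf hZ hP NH A₀ hA₀ hA₀').Prop42_ii :=
  prop42_ii_mkOfModelCanonical X tf hZ hP _ _ _ NH A₀ hA₀ hA₀' hpf

/-- **[EtTh] Prop. 4.2 (ii) AS TYPED over `B^temp(Π^tp_X)⁰` from WEAK perf-factoriality** (abc-iut-w6-d037's
`prop42_ii_mkOfModelCanonical_of_weak`). [cite: MochizukiEtTh2009, Prop 4.2 p.88] -/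
theorem prop42_ii_mkOfConnectedTemperoid_of_weak
    (hpfw : ∀ A : (ConnectedPart (BTemp X.Pi))ᵒᵖ, IsPerfFactorialWeak (tf.Φ.carrier A)) :
    (mkOfConnectedTemperoid X tf hZ hP NH A₀ hA₀ hA₀').Prop42_ii :=
  prop42_ii_mkOfModelCanonical_of_weak X tf hZ hP _ _ _ NH A₀ hA₀ hA₀' hpfw

/-- **[EtTh] Prop. 4.2 (ii) AS PRINTED («iff») over `B^temp(Π^tp_X)⁰` from WEAK perf-factoriality**
(abc-iut-w6-d037's `prop42_ii_iff_mkOfModelCanonical_of_weak`: the sufficiency `FractionPair.exists_iso_comp_left`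
+ the typed necessity/uniqueness). [cite: MochizukiEtTh2009, Prop 4.2 p.88] -/
theorem prop42_ii_iff_mkOfConnectedTemperoid_of_weak
    (hpfw : ∀ A : (ConnectedPart (BTemp X.Pi))ᵒᵖ, IsPerfFactorialWeak (tf.Φ.carrier A))
    {A B C : (mkOfConnectedTemperoid X tf hZ hP NH A₀ hA₀ hA₀').C}
    (f : (mkOfConnectedTemperoid X tf hZ hP NH A₀ hA₀ hA₀').biratUnits A)
    (P : (mkOfConnectedTemperoid X tf hZ hP NH A₀ hA₀ hA₀').FractionPair f B) (t' t'' : C ⟶ B) :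
    (∃ (g : (mkOfConnectedTemperoid X tf hZ hP NH A₀ hA₀ hA₀').biratUnits C)
        (Q : (mkOfConnectedTemperoid X tf hZ hP NH A₀ hA₀ hA₀').FractionPair g B),
        Q.num = t' ∧ Q.den = t'' ∧ Q.restrict = P.restrict) ↔
      ∃! v : C ≅ A, v.hom ≫ P.num = t' ∧ v.hom ≫ P.den = t'' :=
  prop42_ii_iff_mkOfModelCanonical_of_weak X tf hZ hP _ _ _ NH A₀ hA₀ hA₀' hpfw f P t' t''

/-- **[EtTh] Prop. 4.2 (ii) AS PRINTED («iff») over `B^temp(Π^tp_X)⁰`** modulo «every `Φ(A)` perf-factorial»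
(the strong binder is a special case, `IsPerfFactorial.weak`). [cite: MochizukiEtTh2009, Prop 4.2 p.88] -/
theorem prop42_ii_iff_mkOfConnectedTemperoid
    (hpf : ∀ A : (ConnectedPart (BTemp X.Pi))ᵒᵖ, IsPerfFactorial (tf.Φ.carrier A))
    {A B C : (mkOfConnectedTemperoid X tf hZ hP NH A₀ hA₀ hA₀').C}
    (f : (mkOfConnectedTemperoid X tf hZ hP NH A₀ hA₀ hA₀').biratUnits A)
    (P : (mkOfConnectedTemperoid X tf hZ hP NH A₀ hA₀ hA₀').FractionPair f B) (t' t'' : C ⟶ B) :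
    (∃ (g : (mkOfConnectedTemperoid X tf hZ hP NH A₀ hA₀ hA₀').biratUnits C)
        (Q : (mkOfConnectedTemperoid X tf hZ hP NH A₀ hA₀ hA₀').FractionPair g B),
        Q.num = t' ∧ Q.den = t'' ∧ Q.restrict = P.restrict) ↔
      ∃! v : C ≅ A, v.hom ≫ P.num = t' ∧ v.hom ≫ P.den = t'' :=
  prop42_ii_iff_mkOfConnectedTemperoid_of_weak X tf hZ hP NH A₀ hA₀ hA₀' (fun A => (hpf A).weak) f P t' t''

end Setting

section Quot

variable (M : OpenNormalSubgroup X.Pi)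

/-- **Prop. 4.2 (i) AS TYPED at the canonical `A_⊙ := (Π^tp_X/M, 0)`** over `B^temp(Π^tp_X)⁰` (abc-iut-L2-t4's
`mkOfConnectedTemperoidQuot`; `H_⊙ = M`), modulo «every `Φ(A)` perf-factorial» only.
[cite: MochizukiEtTh2009, Prop 4.2 p.88] -/
theorem prop42_i_mkOfConnectedTemperoidQuot
    (hpf : ∀ A : (ConnectedPart (BTemp X.Pi))ᵒᵖ, IsPerfFactorial (tf.Φ.carrier A)) :
    (mkOfConnectedTemperoidQuot X tf hZ hP NH M).Prop42_i :=
  prop42_i_mkOfConnectedTemperoid X tf hZ hP NH _ _ _ hpf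

/-- **Prop. 4.2 (ii) AS TYPED at the canonical `A_⊙ := (Π^tp_X/M, 0)`**, modulo «every `Φ(A)` perf-factorial»
only. [cite: MochizukiEtTh2009, Prop 4.2 p.88] -/
theorem prop42_ii_mkOfConnectedTemperoidQuot
    (hpf : ∀ A : (ConnectedPart (BTemp X.Pi))ᵒᵖ, IsPerfFactorial (tf.Φ.carrier A)) :
    (mkOfConnectedTemperoidQuot X tf hZ hP NH M).Prop42_ii :=
  prop42_ii_mkOfConnectedTemperoid X tf hZ hP NH _ _ _ hpf

end Quot

section Ydd

variable {N : ℕ+} (T : ThetaEnvData.{max u₀ w} N) (ιX : T.PiX ≃ₜ* X.Pi)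

/-- **Prop. 4.2 (i) AS TYPED at the §5 choice `A_⊙^bs := Ÿ`** (`A_⊙ := (Π^tp_X/ιX(Π^tp_Ÿ), 0)`, abc-iut-L2-t4's
`mkOfConnectedTemperoidYdd`), modulo «every `Φ(A)` perf-factorial» only. [cite: MochizukiEtTh2009, Prop 4.2 p.88] -/
theorem prop42_i_mkOfConnectedTemperoidYdd
    (hpf : ∀ A : (ConnectedPart (BTemp X.Pi))ᵒᵖ, IsPerfFactorial (tf.Φ.carrier A)) :
    (mkOfConnectedTemperoidYdd X tf hZ hP NH T ιX).Prop42_i :=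
  prop42_i_mkOfConnectedTemperoidQuot X tf hZ hP NH _ hpf

/-- **Prop. 4.2 (ii) AS TYPED at the §5 choice `A_⊙^bs := Ÿ`**, modulo «every `Φ(A)` perf-factorial» only.
[cite: MochizukiEtTh2009, Prop 4.2 p.88] -/
theorem prop42_ii_mkOfConnectedTemperoidYdd
    (hpf : ∀ A : (ConnectedPart (BTemp X.Pi))ᵒᵖ, IsPerfFactorial (tf.Φ.carrier A)) :
    (mkOfConnectedTemperoidYdd X tf hZ hP NH T ιX).Prop42_ii :=
  prop42_ii_mkOfConnectedTemperoidQuot X tf hZ hP NH _ hpf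

end Ydd

end AnyVocab

/-! ## §2 The canonical monoid vocabulary `treeMonoidVocab` ([FrdI] Def. 2.4 (i) as printed): NO binder -/

section TreeVocab

variable (X : SemiGraphs.TemperedArithmeticGroup.{u₀} K) {D₀ : Type u₀} [Category.{v₀} D₀]
  {T₀ : RealifiedDivisorMonoids (D₀ := D₀) treeMonoidVocab.{w}}
  {VD : FrdICatStub.{u₀ + 1, u₀, w} (ConnectedPart (BTemp X.Pi))}
  (tf : TemperedFrobenioid T₀ (ConnectedPart (BTemp X.Pi)) VD) (hZ : tf.monoidType = MonoidType.Z)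
  (hP : ∀ A : (ConnectedPart (BTemp X.Pi))ᵒᵖ, IsPerfect (tf.Φ.carrier A))
  (NH : Subgroup (Field.absoluteGaloisGroup K) → tf.category → ℕ+ → Prop)

section Setting

variable (A₀ : tf.category) (hA₀ : PreFrobenioid.IsFrobeniusTrivial tf.toElem A₀)
  (hA₀' : SemiGraphs.IsGaloisObj A₀.base.obj)

/-- **[EtTh] Prop. 4.2 (i) AS TYPED over `B^temp(Π^tp_X)⁰` and `treeMonoidVocab` — NO BINDER**: «`Φ` perf-factorial»
is the Def. 3.6 (ii) field `TemperedFrobenioid.isPerfFactorial`.  A theorem about every tempered Frobenioid `tf`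
of monoid type `ℤ` with perfect divisor monoid over `B^temp(Π^tp_X)⁰`, every `NH`, every Frobenius-trivial Galois
`A_⊙`. [cite: MochizukiEtTh2009, Prop 4.2 p.88] -/
theorem prop42_i_mkOfConnectedTemperoid_treeVocab :
    Prop42_i (V := treeMonoidVocab) (mkOfConnectedTemperoid X tf hZ hP NH A₀ hA₀ hA₀') :=
  prop42_i_mkOfConnectedTemperoid X tf hZ hP NH A₀ hA₀ hA₀' fun A => tf.isPerfFactorial A

/-- **[EtTh] Prop. 4.2 (ii) AS TYPED over `B^temp(Π^tp_X)⁰` and `treeMonoidVocab` — NO BINDER.**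
[cite: MochizukiEtTh2009, Prop 4.2 p.88] -/
theorem prop42_ii_mkOfConnectedTemperoid_treeVocab :
    Prop42_ii (V := treeMonoidVocab) (mkOfConnectedTemperoid X tf hZ hP NH A₀ hA₀ hA₀') :=
  prop42_ii_mkOfConnectedTemperoid X tf hZ hP NH A₀ hA₀ hA₀' fun A => tf.isPerfFactorial A

/-- **[EtTh] Prop. 4.2 (ii) AS PRINTED («iff») over `B^temp(Π^tp_X)⁰` and `treeMonoidVocab` — NO BINDER.**
[cite: MochizukiEtTh2009, Prop 4.2 p.88] -/
theorem prop42_ii_iff_mkOfConnectedTemperoid_treeVocab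
    {A B C : (mkOfConnectedTemperoid X tf hZ hP NH A₀ hA₀ hA₀').C}
    (f : (mkOfConnectedTemperoid X tf hZ hP NH A₀ hA₀ hA₀').biratUnits A)
    (P : (mkOfConnectedTemperoid X tf hZ hP NH A₀ hA₀ hA₀').FractionPair f B) (t' t'' : C ⟶ B) :
    (∃ (g : biratUnits (V := treeMonoidVocab) (mkOfConnectedTemperoid X tf hZ hP NH A₀ hA₀ hA₀') C)
        (Q : (mkOfConnectedTemperoid X tf hZ hP NH A₀ hA₀ hA₀').FractionPair g B),
        Q.num = t' ∧ Q.den = t'' ∧ Q.restrict = P.restrict) ↔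
      ∃! v : C ≅ A, v.hom ≫ P.num = t' ∧ v.hom ≫ P.den = t'' :=
  prop42_ii_iff_mkOfConnectedTemperoid X tf hZ hP NH A₀ hA₀ hA₀' (fun A => tf.isPerfFactorial A) f P t' t''

/-- **The cone node `EtTh:Prop4.2(i)` at its instance of record, with the FULLY-QUALIFIED head** (cell FQ-TYPE
rule; head-match form of FACT-LIST F-0488 «instance form»): the typed named `Prop`
`Literature.AnabelianGeometry.EtaleTheta.BiKummerSetting.Prop42_i S` HOLDS for `S :=` the canonical §4 setting over
the genuine connected base `B^temp(Π^tp_X)⁰` at the canonical monoid vocabulary, for every `X`, `tf`, `NH`, `A_⊙` —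
no hypothesis. [cite: MochizukiEtTh2009, Prop 4.2 p.88] -/
theorem prop42_i_holds_mkOfConnectedTemperoid_treeVocab :
    Literature.AnabelianGeometry.EtaleTheta.BiKummerSetting.Prop42_i (V := treeMonoidVocab)
      (mkOfConnectedTemperoid X tf hZ hP NH A₀ hA₀ hA₀') :=
  prop42_i_mkOfConnectedTemperoid_treeVocab X tf hZ hP NH A₀ hA₀ hA₀'

/-- **The companion node `EtTh:Prop4.2(ii)` at the same instance, FULLY-QUALIFIED head** (F-0489 «instance
form»): no hypothesis. [cite: MochizukiEtTh2009, Prop 4.2 p.88] -/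
theorem prop42_ii_holds_mkOfConnectedTemperoid_treeVocab :
    Literature.AnabelianGeometry.EtaleTheta.BiKummerSetting.Prop42_ii (V := treeMonoidVocab)
      (mkOfConnectedTemperoid X tf hZ hP NH A₀ hA₀ hA₀') :=
  prop42_ii_mkOfConnectedTemperoid_treeVocab X tf hZ hP NH A₀ hA₀ hA₀'

end Setting

/-- **Prop. 4.2 (i) AS TYPED at the canonical `A_⊙ := (Π^tp_X/M, 0)` over `treeMonoidVocab` — NO BINDER**
(FQ head; every open normal `M ⊴ Π^tp_X`). [cite: MochizukiEtTh2009, Prop 4.2 p.88] -/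
theorem prop42_i_holds_mkOfConnectedTemperoidQuot_treeVocab (M : OpenNormalSubgroup X.Pi) :
    Literature.AnabelianGeometry.EtaleTheta.BiKummerSetting.Prop42_i (V := treeMonoidVocab)
      (mkOfConnectedTemperoidQuot X tf hZ hP NH M) :=
  prop42_i_mkOfConnectedTemperoidQuot X tf hZ hP NH M fun A => tf.isPerfFactorial A

/-- **Prop. 4.2 (ii) AS TYPED at the canonical `A_⊙ := (Π^tp_X/M, 0)` over `treeMonoidVocab` — NO BINDER**
(FQ head). [cite: MochizukiEtTh2009, Prop 4.2 p.88] -/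
theorem prop42_ii_holds_mkOfConnectedTemperoidQuot_treeVocab (M : OpenNormalSubgroup X.Pi) :
    Literature.AnabelianGeometry.EtaleTheta.BiKummerSetting.Prop42_ii (V := treeMonoidVocab)
      (mkOfConnectedTemperoidQuot X tf hZ hP NH M) :=
  prop42_ii_mkOfConnectedTemperoidQuot X tf hZ hP NH M fun A => tf.isPerfFactorial A

/-- **Prop. 4.2 (i) AS TYPED at the §5 choice `A_⊙^bs := Ÿ` over `treeMonoidVocab` — NO BINDER** (FQ head; every
mono-theta-environment datum `T` and every `ιX : Π_X ≃ Π^tp_X`). [cite: MochizukiEtTh2009, Prop 4.2 p.88] -/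
theorem prop42_i_holds_mkOfConnectedTemperoidYdd_treeVocab {N : ℕ+} (T : ThetaEnvData.{max u₀ w} N)
    (ιX : T.PiX ≃ₜ* X.Pi) :
    Literature.AnabelianGeometry.EtaleTheta.BiKummerSetting.Prop42_i (V := treeMonoidVocab)
      (mkOfConnectedTemperoidYdd X tf hZ hP NH T ιX) :=
  prop42_i_mkOfConnectedTemperoidYdd X tf hZ hP NH T ιX fun A => tf.isPerfFactorial A

/-- **Prop. 4.2 (ii) AS TYPED at the §5 choice `A_⊙^bs := Ÿ` over `treeMonoidVocab` — NO BINDER** (FQ head).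
[cite: MochizukiEtTh2009, Prop 4.2 p.88] -/
theorem prop42_ii_holds_mkOfConnectedTemperoidYdd_treeVocab {N : ℕ+} (T : ThetaEnvData.{max u₀ w} N)
    (ιX : T.PiX ≃ₜ* X.Pi) :
    Literature.AnabelianGeometry.EtaleTheta.BiKummerSetting.Prop42_ii (V := treeMonoidVocab)
      (mkOfConnectedTemperoidYdd X tf hZ hP NH T ιX) :=
  prop42_ii_mkOfConnectedTemperoidYdd X tf hZ hP NH T ιX fun A => tf.isPerfFactorial A

end TreeVocab

/-! ## §3 The weak canonical vocabulary `treeMonoidVocabWeak` (F-L2d2-1): NO binder -/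

section TreeVocabWeak

variable (X : SemiGraphs.TemperedArithmeticGroup.{u₀} K) {D₀ : Type u₀} [Category.{v₀} D₀]
  {T₀ : RealifiedDivisorMonoids (D₀ := D₀) treeMonoidVocabWeak.{w}}
  {VD : FrdICatStub.{u₀ + 1, u₀, w} (ConnectedPart (BTemp X.Pi))}
  (tf : TemperedFrobenioid T₀ (ConnectedPart (BTemp X.Pi)) VD) (hZ : tf.monoidType = MonoidType.Z)
  (hP : ∀ A : (ConnectedPart (BTemp X.Pi))ᵒᵖ, IsPerfect (tf.Φ.carrier A))
  (NH : Subgroup (Field.absoluteGaloisGroup K) → tf.category → ℕ+ → Prop)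

section Setting

variable (A₀ : tf.category) (hA₀ : PreFrobenioid.IsFrobeniusTrivial tf.toElem A₀)
  (hA₀' : SemiGraphs.IsGaloisObj A₀.base.obj)

/-- **[EtTh] Prop. 4.2 (i) AS TYPED over `B^temp(Π^tp_X)⁰` and `treeMonoidVocabWeak` — NO BINDER**: the Def. 3.6
(ii) field reads `IsPerfFactorialCof`, whence weakly perf-factorial (abc-iut-w6-d037's
`isPerfFactorialWeak_of_treeVocabWeak`). [cite: MochizukiEtTh2009, Prop 4.2 p.88] -/
theorem prop42_i_mkOfConnectedTemperoid_treeVocabWeak :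
    Prop42_i (V := treeMonoidVocabWeak) (mkOfConnectedTemperoid X tf hZ hP NH A₀ hA₀ hA₀') :=
  prop42_i_mkOfConnectedTemperoid_of_weak X tf hZ hP NH A₀ hA₀ hA₀' (isPerfFactorialWeak_of_treeVocabWeak tf)

/-- **[EtTh] Prop. 4.2 (ii) AS TYPED over `B^temp(Π^tp_X)⁰` and `treeMonoidVocabWeak` — NO BINDER.**
[cite: MochizukiEtTh2009, Prop 4.2 p.88] -/
theorem prop42_ii_mkOfConnectedTemperoid_treeVocabWeak :
    Prop42_ii (V := treeMonoidVocabWeak) (mkOfConnectedTemperoid X tf hZ hP NH A₀ hA₀ hA₀') :=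
  prop42_ii_mkOfConnectedTemperoid_of_weak X tf hZ hP NH A₀ hA₀ hA₀' (isPerfFactorialWeak_of_treeVocabWeak tf)

/-- **[EtTh] Prop. 4.2 (ii) AS PRINTED («iff») over `B^temp(Π^tp_X)⁰` and `treeMonoidVocabWeak` — NO BINDER.**
[cite: MochizukiEtTh2009, Prop 4.2 p.88] -/
theorem prop42_ii_iff_mkOfConnectedTemperoid_treeVocabWeak
    {A B C : (mkOfConnectedTemperoid X tf hZ hP NH A₀ hA₀ hA₀').C}
    (f : (mkOfConnectedTemperoid X tf hZ hP NH A₀ hA₀ hA₀').biratUnits A)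
    (P : (mkOfConnectedTemperoid X tf hZ hP NH A₀ hA₀ hA₀').FractionPair f B) (t' t'' : C ⟶ B) :
    (∃ (g : biratUnits (V := treeMonoidVocabWeak) (mkOfConnectedTemperoid X tf hZ hP NH A₀ hA₀ hA₀') C)
        (Q : (mkOfConnectedTemperoid X tf hZ hP NH A₀ hA₀ hA₀').FractionPair g B),
        Q.num = t' ∧ Q.den = t'' ∧ Q.restrict = P.restrict) ↔
      ∃! v : C ≅ A, v.hom ≫ P.num = t' ∧ v.hom ≫ P.den = t'' :=
  prop42_ii_iff_mkOfConnectedTemperoid_of_weak X tf hZ hP NH A₀ hA₀ hA₀' (isPerfFactorialWeak_of_treeVocabWeak tf)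
    f P t' t''

/-- **The cone node `EtTh:Prop4.2(i)`, FULLY-QUALIFIED head, at the weak canonical vocabulary** — no hypothesis.
[cite: MochizukiEtTh2009, Prop 4.2 p.88] -/
theorem prop42_i_holds_mkOfConnectedTemperoid_treeVocabWeak :
    Literature.AnabelianGeometry.EtaleTheta.BiKummerSetting.Prop42_i (V := treeMonoidVocabWeak)
      (mkOfConnectedTemperoid X tf hZ hP NH A₀ hA₀ hA₀') :=
  prop42_i_mkOfConnectedTemperoid_treeVocabWeak X tf hZ hP NH A₀ hA₀ hA₀'

/-- **The companion node `EtTh:Prop4.2(ii)`, FULLY-QUALIFIED head, at the weak canonical vocabulary** — no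
hypothesis. [cite: MochizukiEtTh2009, Prop 4.2 p.88] -/
theorem prop42_ii_holds_mkOfConnectedTemperoid_treeVocabWeak :
    Literature.AnabelianGeometry.EtaleTheta.BiKummerSetting.Prop42_ii (V := treeMonoidVocabWeak)
      (mkOfConnectedTemperoid X tf hZ hP NH A₀ hA₀ hA₀') :=
  prop42_ii_mkOfConnectedTemperoid_treeVocabWeak X tf hZ hP NH A₀ hA₀ hA₀'

end Setting

/-- **Prop. 4.2 (i) AS TYPED at `A_⊙ := (Π^tp_X/M, 0)` over `treeMonoidVocabWeak` — NO BINDER** (FQ head).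
[cite: MochizukiEtTh2009, Prop 4.2 p.88] -/
theorem prop42_i_holds_mkOfConnectedTemperoidQuot_treeVocabWeak (M : OpenNormalSubgroup X.Pi) :
    Literature.AnabelianGeometry.EtaleTheta.BiKummerSetting.Prop42_i (V := treeMonoidVocabWeak)
      (mkOfConnectedTemperoidQuot X tf hZ hP NH M) :=
  prop42_i_mkOfConnectedTemperoid_treeVocabWeak X tf hZ hP NH _ _ _

/-- **Prop. 4.2 (i) AS TYPED at the §5 choice `A_⊙^bs := Ÿ` over `treeMonoidVocabWeak` — NO BINDER** (FQ head).
[cite: MochizukiEtTh2009, Prop 4.2 p.88] -/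
theorem prop42_i_holds_mkOfConnectedTemperoidYdd_treeVocabWeak {N : ℕ+} (T : ThetaEnvData.{max u₀ w} N)
    (ιX : T.PiX ≃ₜ* X.Pi) :
    Literature.AnabelianGeometry.EtaleTheta.BiKummerSetting.Prop42_i (V := treeMonoidVocabWeak)
      (mkOfConnectedTemperoidYdd X tf hZ hP NH T ιX) :=
  prop42_i_holds_mkOfConnectedTemperoidQuot_treeVocabWeak X tf hZ hP NH _

end TreeVocabWeak

end BiKummerSetting

end Literature.AnabelianGeometry.EtaleTheta

end
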